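import Summits.NavierStokesRegularity.NavierStokesRegularity.Theses.PlaneEnergyCeiling

/-!
# Route PlaneEnergyCeiling · glue `BoundedRegularityOfLiouvilleZoomA`
# (stmt-NavierStokesRegularity-17966) — proved

The second layer of the route's deciding theorem made explicit:
`PlanarEnergyLiouville → PlanarEnergyZoomA → BoundedPlanarEnergyRegularity`. Pure logic over the
route decls: under the planar hypothesis for the datum `u₀`, if Clay (A) failed, the (A)-form zoom
`PlanarEnergyZoomA` would deliver a non-zero bounded ancient mild solution (`ν = 1`), measurable,
jointly smooth on `(−∞,0) × ℝ³`, with uniformly bounded planar energies, which the Liouville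
theorem `PlanarEnergyLiouville` forces to vanish identically — contradiction. (The same four lines
form the first step of `Theses.PlaneEnergyCeiling.closes`.)

References: KNSS 2009; Albritton–Barker 2019; Seregin–Šverák 2009. [KNSS2009]
-/

-- single-conjunct summit: `Summit.<Summit>.<Problem>` repeats the name by the D-0017 layout
set_option linter.dupNamespace false

namespace Summit.NavierStokesRegularity.NavierStokesRegularity.Theorems

open Summit.NavierStokesRegularity.NavierStokesRegularity.Theses.PlaneEnergyCeiling in
/-- **Glue `BoundedRegularityOfLiouvilleZoomA` (stmt-NavierStokesRegularity-17966), proved**: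
Liouville in the planar-energy class and the (A)-form velocity-record zoom imply the criterion
"bounded planar energy along every classical Leray–Hopf solution from `u₀` ⇒ Clay (A) for `u₀`"
(by contradiction: the zoom's non-zero ancient solution is killed by the Liouville theorem). -/
theorem boundedRegularityOfLiouvilleZoomA_proof :
    Summit.NavierStokesRegularity.NavierStokesRegularity.Theses.PlaneEnergyCeiling.BoundedRegularityOfLiouvilleZoomA := by
  intro h₃ h₅ ν hν u₀ hu₀ hdiv hdec hpl
  by_contra hA
  obtain ⟨v, M', hm, hmeas, hsm, hpb, t, ht, x, hx⟩ := h₅ ν hν u₀ hu₀ hdiv hdec hpl hA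
  exact hx (h₃ v hm hmeas hsm ⟨M', hpb⟩ t ht x)

end Summit.NavierStokesRegularity.NavierStokesRegularity.Theorems
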